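import Summits.HodgeConjecture.CorCM.Hyp413.A3Liu413FaceTypes
import HarnessLib

/-!
# FLOOR-0 P4, seat S4′(i) TASK 0 — the LINE OF AN ADMISSIBLE TRIPLE and the INTRINSIC SIGN deciding the `ι₁`-class

Cell hodgecm-mathlib (D-0151), FLOOR 0, crux item H413 = stmt-HodgeConjecture-24833; programme P4, line
`Cruxes/H413/Lines/F0_P4AdmissibleOccursInH1.lean` (F0P4-plan (g0), director s341), stub S4′ `stub_T3a_holThetaRealisationOfRallisAt`
(node `StubT3aHolThetaRealisationAt`, a DISJUNCTION over the two `ι₁`-classes of weight-one admissible triples).  Author F0P4-p01 (g0),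
seat (i) of DECISIONS-T3a v1 (D1 «TASK 0: decide the disjunct by a kernel lemma»).  `--supports stmt-HodgeConjecture-24833`.

WHAT IS PROVED (kernel, no citation is load-bearing).  For a CM field `L`, a CM type `Φ`, a purely imaginary `δ ≠ 0` and an element `e`
that is `Φ`-ADMISSIBLE in the sense of [Liu2021, Def. 4.12] (★ `IsAdmissibleElement L Φ e`: `e ≠ 0`, `ē = −e`, `Im τ(e) < 0` for `τ ∈ Φ`):

* §1 `(e * (2 * δ)) := e · (2δ)` is a NON-ZERO element of `L⁺` (`lineScalar_mem`, `lineScalar_ne_zero`) — it is the argument of ★ `fPart` in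
  ★ `Def411WeilCarriers.epsOf … δ′ e` at the pin's normalisation `δ′ = (2δ)⁻¹`; under every complex embedding `τ`,
  `re τ(e·2δ) = −2 · im τ(δ) · im τ(e)` and `im τ(δ · e·2δ) = −2 · (im τ(δ))² · im τ(e)` (`re_embedding_lineScalar`, `im_embedding_delta_mul_lineScalar`);
* §1 **`IsAdmissibleElement.mem_iff_im_pos`** — THE DECIDING LEMMA: for every `τ`, `τ ∈ Φ ↔ 0 < im τ(δ · (e * (2 * δ)))`; equivalently
  (`mem_iff_re_pos_iff`) `τ ∈ Φ ↔ (0 < re τ((e * (2 * δ))) ↔ 0 < im τ(δ))`.  The first form is INTRINSIC (it does not change under `δ ↦ −δ`,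
  which replaces `(e * (2 * δ))` by its negative); the second shows that the sign of the REAL line scalar itself is tied to `Φ` only through the
  sign of `im τ(δ)` — for the tree's `δ = imagUnit L` (a `Classical.choose`) that sign is not decidable in the kernel;
* §2 `epsOf L⁺ d L (2δ)⁻¹ e = locF L⁺ d ⟨e·2δ⟩` (`epsOf_eq_locF_mk0`): the collection of `e` IS the collection of the global real
  unit `⟨e·2δ⟩ ∈ (L⁺)ˣ` (`Units.mk0`), so `⟨e·2δ⟩` is a hermitian line of record for the class `epsOf e` WITH CONTROLLED archimedean signs;
* §3 AT THE PIN `datum413 hDel F V a₀ Φ i` (★ `A3Liu413FaceTypes`; its `epsOf` is `Def411WeilCarriers.epsOf L⁺ (imagUnitSq L) L (2·imagUnit L)⁻¹` by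
  `rfl`, `L = K F`): every ADMISSIBLE triple `t` (★ `Prop413Data.Triple.IsAdmissible`) has a witness `e` and a real unit `a = ⟨e · 2·imagUnit L⟩`
  with `locF a = t.ε` and, for every `τ`, `τ ∈ Φ_μ(t) ↔ 0 < im τ(imagUnit L · a)` (`exists_admissibleLine`); in particular at the distinguished `ι₁`
  (`mem_cmType_iff_of_admissibleLine`).

CONSEQUENCE FOR S4′ (recorded, not a theorem of this file): the pin realises `ω_V(t)` on the line `⟨(r μ hμ).toFun t.ε⟩` whose representative is
★ `lineOf t.ε` (a `Classical.choose`, ★ `Rep.ofLineOf`/`Rep.update`) — its archimedean signs are NOT controlled by `t`, so the planner's proposed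
`holClass_iff` over that representative is not a kernel statement; the theta realisation must be built on the admissible line `⟨e · 2·imagUnit⟩` of §3
(same finite collection, `locF a = t.ε`) and transported, and the disjunct of `StubT3aHolThetaRealisationAt` that holds is decided by the sign of
`im ι₁(imagUnit (K F))` through `mem_iff_re_pos_iff` once the model's «positive line ⇒ holomorphic» theorem is applied.
HC_CM is proved only modulo the printed citations until rung 0 closes; this file proves nothing about them.

## References
* [Liu2021] Y. Liu, *Fourier–Jacobi cycles and arithmetic relative trace formula*, Camb. J. Math. 9 (2021) = arXiv:2102.11518 — Def. 4.11,
  Def. 4.12 (ll. 2102–2108), App. D Lem. D.2 (2).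
* Tree: ★ `Literature/AlgebraicGeometry/Liu2021/AdmissibleElement` (`IsAdmissibleElement`), ★ `Literature/NumberTheory/Automorphic/Liu2021/Def411WeilCarriers`
  (`Eps`, `locF`, `fPart`, `epsOf`), ★ `Literature/NumberTheory/GelbartRogawski1991/UnitaryDualPairThetaKernelCM` (`imagUnit`, `imagUnitSq`),
  ★ `CorCM/Hyp413/A3Liu413FaceTypes` (`datum413`), Mathlib `NumberField.IsCMField.complexEmbedding_complexConj`.
-/

set_option autoImplicit false
set_option linter.dupNamespace false

noncomputable section

open NumberField NumberField.InfinitePlace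
open scoped ComplexConjugate
open Literature.AlgebraicGeometry.Motives (CMType)
open Literature.AlgebraicGeometry.Liu2021 (IsAdmissibleElement)
open Literature.NumberTheory.Automorphic.Liu2021.Def411WeilCarriers (Eps locF fPart epsOf)
open Literature.NumberTheory.GelbartRogawski1991.UnitaryDualPair (imagUnit imagUnitSq complexConj_imagUnit imagUnit_ne_zero)

namespace Summit.HodgeConjecture.HodgeConjecture.Cruxes.H413.AdmissibleLine

/-! ## §1 Purely imaginary elements, the real line scalar `e·2δ`, and the deciding sign -/

section Generic

variable {L : Type} [Field L] [NumberField L] [IsCMField L]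

/-- A purely imaginary element has real part `0` under every complex embedding. [folklore] -/
theorem re_embedding_eq_zero_of_skew {ζ : L} (hζ : IsCMField.complexConj L ζ = -ζ) (τ : L →+* ℂ) : (τ ζ).re = 0 := by
  have h := IsCMField.complexEmbedding_complexConj L τ ζ
  rw [hζ, map_neg] at h
  have h2 := congrArg Complex.re h
  simp only [Complex.neg_re, Complex.conj_re] at h2
  linarith

/-- A purely imaginary element is `i · im τ(ζ)` under every complex embedding. [folklore] -/
theorem embedding_eq_of_skew {ζ : L} (hζ : IsCMField.complexConj L ζ = -ζ) (τ : L →+* ℂ) : τ ζ = ((τ ζ).im : ℂ) * Complex.I :=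
  Complex.ext (by simp [re_embedding_eq_zero_of_skew hζ τ]) (by simp)

/-- A non-zero purely imaginary element has non-zero imaginary part under every complex embedding. [folklore] -/
theorem im_embedding_ne_zero_of_skew {ζ : L} (hζ : IsCMField.complexConj L ζ = -ζ) (hζ0 : ζ ≠ 0) (τ : L →+* ℂ) : (τ ζ).im ≠ 0 := by
  intro h
  apply hζ0
  have : τ ζ = 0 := Complex.ext (by rw [re_embedding_eq_zero_of_skew hζ τ]; rfl) (by rw [h]; rfl)
  exact (map_eq_zero τ).mp this

/-- An element fixed by complex conjugation is real under every complex embedding. [folklore] -/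
theorem im_embedding_eq_zero_of_real {a : L} (ha : IsCMField.complexConj L a = a) (τ : L →+* ℂ) : (τ a).im = 0 := by
  have h := IsCMField.complexEmbedding_complexConj L τ a
  rw [ha] at h
  have h2 := congrArg Complex.im h
  simp only [Complex.conj_im] at h2
  linarith

omit [NumberField L] [IsCMField L] in
/-- The conjugate embedding negates imaginary parts. [folklore] -/
theorem im_conjugate_embedding (τ : L →+* ℂ) (x : L) : (ComplexEmbedding.conjugate τ x).im = -(τ x).im := by
  rw [ComplexEmbedding.conjugate_coe_eq, Complex.conj_im]

omit [NumberField L] [IsCMField L] in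
/-- The CM-type axiom read at the conjugate embedding: `τ̄ ∈ Φ ↔ τ ∉ Φ`. [folklore] -/
theorem conjugate_mem_cmType_iff (Φ : CMType L) (τ : L →+* ℂ) : ComplexEmbedding.conjugate τ ∈ Φ.1 ↔ τ ∉ Φ.1 := by
  have h := Φ.2 (ComplexEmbedding.conjugate τ)
  have hs : ComplexEmbedding.conjugate (ComplexEmbedding.conjugate τ) = τ := star_star τ
  rwa [hs] at h

/-- the product of two purely imaginary elements is fixed by complex conjugation; so is `(e * (2 * δ))`. [folklore] -/
theorem complexConj_lineScalar {δ e : L} (hδ : IsCMField.complexConj L δ = -δ) (he : IsCMField.complexConj L e = -e) :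
    IsCMField.complexConj L ((e * (2 * δ))) = (e * (2 * δ)) := by
  simp only [map_mul, map_ofNat, hδ, he]
  ring

/-- `(e * (2 * δ)) ∈ L⁺`. [folklore] -/
theorem lineScalar_mem {δ e : L} (hδ : IsCMField.complexConj L δ = -δ) (he : IsCMField.complexConj L e = -e) :
    (e * (2 * δ)) ∈ maximalRealSubfield L :=
  (IsCMField.complexConj_eq_self_iff L _).1 (complexConj_lineScalar hδ he)

omit [IsCMField L] in
/-- `(e * (2 * δ)) ≠ 0` for `δ, e ≠ 0`. [folklore] -/
theorem lineScalar_ne_zero {δ e : L} (hδ0 : δ ≠ 0) (he0 : e ≠ 0) : (e * (2 * δ)) ≠ 0 :=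
  mul_ne_zero he0 (mul_ne_zero two_ne_zero hδ0)

/-- `re τ(e·2δ) = −2 · im τ(δ) · im τ(e)`. [folklore] -/
theorem re_embedding_lineScalar {δ e : L} (hδ : IsCMField.complexConj L δ = -δ) (he : IsCMField.complexConj L e = -e)
    (τ : L →+* ℂ) : (τ ((e * (2 * δ)))).re = -2 * (τ δ).im * (τ e).im := by
  simp only [map_mul, map_ofNat]
  rw [embedding_eq_of_skew he τ, embedding_eq_of_skew hδ τ]
  simp only [Complex.mul_re, Complex.mul_im, Complex.ofReal_re, Complex.ofReal_im, Complex.I_re, Complex.I_im,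
    Complex.re_ofNat, Complex.im_ofNat]
  ring

/-- `im τ(e·2δ) = 0`. [folklore] -/
theorem im_embedding_lineScalar {δ e : L} (hδ : IsCMField.complexConj L δ = -δ) (he : IsCMField.complexConj L e = -e)
    (τ : L →+* ℂ) : (τ ((e * (2 * δ)))).im = 0 :=
  im_embedding_eq_zero_of_real (complexConj_lineScalar hδ he) τ

/-- `im τ(δ · e·2δ) = −2 · (im τ(δ))² · im τ(e)` — the INTRINSIC quantity (invariant under `δ ↦ −δ`). [folklore] -/
theorem im_embedding_delta_mul_lineScalar {δ e : L} (hδ : IsCMField.complexConj L δ = -δ) (he : IsCMField.complexConj L e = -e)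
    (τ : L →+* ℂ) : (τ (δ * (e * (2 * δ)))).im = -2 * (τ δ).im ^ 2 * (τ e).im := by
  rw [map_mul, Complex.mul_im, re_embedding_lineScalar hδ he τ, im_embedding_lineScalar hδ he τ,
    re_embedding_eq_zero_of_skew hδ τ]
  ring

/-- an admissible element has NEGATIVE imaginary part at the embeddings of `Φ` (definition). [cite: Liu2021, Def. 4.12 (l. 2107)] -/
theorem im_neg_of_mem {Φ : Set (L →+* ℂ)} {e : L} (he : IsAdmissibleElement L Φ e) {τ : L →+* ℂ} (hτ : τ ∈ Φ) :
    (τ e).im < 0 :=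
  he.2.2 τ hτ

/-- … and POSITIVE imaginary part at the embeddings OFF a CM type `Φ` (their conjugates lie in `Φ`). [cite: Liu2021, Def. 4.12 (l. 2107)] -/
theorem im_pos_of_notMem (Φ : CMType L) {e : L} (he : IsAdmissibleElement L Φ.1 e) {τ : L →+* ℂ} (hτ : τ ∉ Φ.1) :
    0 < (τ e).im := by
  have h := im_neg_of_mem he ((conjugate_mem_cmType_iff Φ τ).2 hτ)
  rw [im_conjugate_embedding] at h
  linarith

/-- **THE DECIDING LEMMA (intrinsic form).**  For a `Φ`-admissible `e` and a purely imaginary `δ ≠ 0`: an embedding `τ` lies in `Φ` iff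
`0 < im τ(δ · (e * (2 * δ)))` (`= −2 (im τ δ)² im τ(e)`).  [cite: Liu2021, Def. 4.12 (ll. 2102–2108); App. D Lem. D.2 (2)] -/
theorem IsAdmissibleElement.mem_iff_im_pos (Φ : CMType L) {e : L} (he : IsAdmissibleElement L Φ.1 e) {δ : L}
    (hδ : IsCMField.complexConj L δ = -δ) (hδ0 : δ ≠ 0) (τ : L →+* ℂ) :
    τ ∈ Φ.1 ↔ 0 < (τ (δ * (e * (2 * δ)))).im := by
  rw [im_embedding_delta_mul_lineScalar hδ he.2.1 τ]
  have hd : 0 < (τ δ).im ^ 2 := by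
    have := im_embedding_ne_zero_of_skew hδ hδ0 τ
    positivity
  constructor
  · intro hτ
    have := im_neg_of_mem he hτ
    nlinarith
  · intro h
    by_contra hτ
    have := im_pos_of_notMem Φ he hτ
    nlinarith

/-- **THE DECIDING LEMMA (real-line form).**  For a `Φ`-admissible `e` and a purely imaginary `δ ≠ 0`: `τ ∈ Φ` iff the real line scalar
`e·2δ` is POSITIVE at `τ` EXACTLY WHEN `im τ(δ)` is (`re τ(e·2δ) = −2 im τ(δ) im τ(e)`).  [cite: Liu2021, Def. 4.12 (ll. 2102–2108); App. D Lem. D.2 (2)] -/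
theorem IsAdmissibleElement.mem_iff_re_pos_iff (Φ : CMType L) {e : L} (he : IsAdmissibleElement L Φ.1 e) {δ : L}
    (hδ : IsCMField.complexConj L δ = -δ) (hδ0 : δ ≠ 0) (τ : L →+* ℂ) :
    τ ∈ Φ.1 ↔ (0 < (τ ((e * (2 * δ)))).re ↔ 0 < (τ δ).im) := by
  rw [re_embedding_lineScalar hδ he.2.1 τ]
  have hδi := im_embedding_ne_zero_of_skew hδ hδ0 τ
  constructor
  · intro hτ
    have he' := im_neg_of_mem he hτ
    constructor
    · intro h
      rcases lt_or_gt_of_ne hδi with hlt | hgt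
      · nlinarith
      · exact hgt
    · intro h
      nlinarith
  · intro h
    by_contra hτ
    have he' := im_pos_of_notMem Φ he hτ
    rcases lt_or_gt_of_ne hδi with hlt | hgt
    · have : 0 < -2 * (τ δ).im * (τ e).im := by nlinarith
      exact absurd (h.1 this) (not_lt.2 hlt.le)
    · have h1 : 0 < -2 * (τ δ).im * (τ e).im := h.2 hgt
      nlinarith

/-- at an embedding OF `Φ` the real line scalar has the sign of `im τ(δ)`: `0 < re τ(e·2δ) ↔ 0 < im τ(δ)`. [cite: Liu2021, Def. 4.12 (ll. 2102–2108)] -/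
theorem IsAdmissibleElement.re_lineScalar_pos_iff_of_mem {Φ : Set (L →+* ℂ)} {e : L} (he : IsAdmissibleElement L Φ e) {δ : L}
    (hδ : IsCMField.complexConj L δ = -δ) (hδ0 : δ ≠ 0) {τ : L →+* ℂ} (hτ : τ ∈ Φ) :
    0 < (τ ((e * (2 * δ)))).re ↔ 0 < (τ δ).im := by
  rw [re_embedding_lineScalar hδ he.2.1 τ]
  have he' := im_neg_of_mem he hτ
  have hδi := im_embedding_ne_zero_of_skew hδ hδ0 τ
  constructor
  · intro h
    rcases lt_or_gt_of_ne hδi with hlt | hgt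
    · nlinarith
    · exact hgt
  · intro h
    nlinarith

end Generic

/-! ## §2 The collection of `e` is the collection of the real unit `⟨e·2δ⟩` -/

section Collection

variable {L : Type} [Field L] [NumberField L] [IsCMField L]

/-- `fPart` of an element of `L⁺` is that element. [folklore] -/
theorem fPart_of_mem {x : L} (hx : x ∈ maximalRealSubfield L) :
    fPart (↥(maximalRealSubfield L)) L x = ⟨x, hx⟩ :=
  Literature.NumberTheory.Automorphic.Liu2021.Def411WeilCarriers.fPart_algebraMap (↥(maximalRealSubfield L)) L ⟨x, hx⟩

/-- the real line scalar `e·2δ`, read as an element of `L⁺`, is non-zero. [folklore] -/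
theorem lineScalar_subtype_ne_zero {δ e : L} (hδ : IsCMField.complexConj L δ = -δ) (hδ0 : δ ≠ 0) (he : IsCMField.complexConj L e = -e)
    (he0 : e ≠ 0) : (⟨e * (2 * δ), lineScalar_mem hδ he⟩ : ↥(maximalRealSubfield L)) ≠ 0 :=
  fun h => lineScalar_ne_zero hδ0 he0 (congrArg Subtype.val h)

/-- **`epsOf e` IS `locF ⟨e·2δ⟩`** at the normalisation `δ′ = (2δ)⁻¹`: the collection of the admissible element is the collection of the GLOBAL REAL
UNIT `⟨e·2δ⟩ ∈ (L⁺)ˣ` whose archimedean signs §1 controls. [cite: Liu2021, Def. 4.12 (l. 2105)] -/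
theorem epsOf_eq_locF_mk0 (d : ↥(maximalRealSubfield L)) {δ e : L} (hδ : IsCMField.complexConj L δ = -δ) (hδ0 : δ ≠ 0)
    (he : IsCMField.complexConj L e = -e) (he0 : e ≠ 0) :
    epsOf (↥(maximalRealSubfield L)) d L (2 * δ)⁻¹ e =
      locF (↥(maximalRealSubfield L)) d (Units.mk0 ⟨e * (2 * δ), lineScalar_mem hδ he⟩ (lineScalar_subtype_ne_zero hδ hδ0 he he0)) := by
  classical
  have hf : fPart (↥(maximalRealSubfield L)) L (e * ((2 * δ)⁻¹)⁻¹) = ⟨e * (2 * δ), lineScalar_mem hδ he⟩ := by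
    rw [inv_inv]
    exact fPart_of_mem (lineScalar_mem hδ he)
  have hne : fPart (↥(maximalRealSubfield L)) L (e * ((2 * δ)⁻¹)⁻¹) ≠ 0 := by
    rw [hf]
    exact lineScalar_subtype_ne_zero hδ hδ0 he he0
  unfold epsOf
  rw [dif_neg hne]
  congr 1
  exact Units.ext (by rw [Units.val_mk0, hf]; rfl)

end Collection

/-! ## §3 At the pin `datum413 hDel F V a₀ Φ i`: the admissible line of a triple and the decided `ι₁`-class -/

section Pin

open HodgeCM HodgeCM.Model HodgeCM.Model.LiuIndex HodgeCM.Model.TowerCarrier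
open Summit.HodgeConjecture.CorCM Summit.HodgeConjecture.CorCM.Transposition
open Summit.HodgeConjecture.CorCM.Model
open Literature.NumberTheory.Automorphic Literature.NumberTheory.Automorphic.Liu2021
open Summit.HodgeConjecture.CorCM.Lines.A3Liu413 (datum413)

set_option synthInstance.maxHeartbeats 400000 in
set_option maxHeartbeats 8000000 in
/-- the pin's carrier `epsOf` IS `Def411WeilCarriers.epsOf L⁺ (imagUnitSq L) L (2·imagUnit L)⁻¹` (`L = K F`; definitional through ★ `uniformOmegaRep` and
★ `UniformOmega.prop413Data`). [cite: Liu2021, Def. 4.12 (l. 2105)] -/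
theorem datum413_epsOf (hDel : Literature.AlgebraicGeometry.ShimuraVarieties.UnitaryCanonicalModel.canonicalModel_exists_printed)
    (F : HodgeCM.CMField) [IsGalois ℚ F] {ι₁ : F →+* ℂ} (V : HodgeCM.HermSpace3 F ι₁) (a₀ : RealScalar F) (Φ : CMType F)
    (i : (I V (repAt a₀) (muLiu ι₁ GramClass.rep))) :
    (datum413 hDel F V a₀ Φ i).epsOf =
      epsOf (↥(maximalRealSubfield (HodgeCM.CMField.K F))) (imagUnitSq (HodgeCM.CMField.K F)) (HodgeCM.CMField.K F)
        (2 * imagUnit (HodgeCM.CMField.K F))⁻¹ :=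
  rfl

set_option synthInstance.maxHeartbeats 400000 in
set_option maxHeartbeats 8000000 in
/-- **THE ADMISSIBLE LINE OF A TRIPLE AT THE PIN.**  Every admissible triple `t` of the pin ([Liu2021, Def. 4.12]: `∃ e` admissible for `Φ_μ(t)` with
`epsOf e = t.ε`) has a witness `e` and a GLOBAL REAL UNIT `a = ⟨e · 2·imagUnit⟩ ∈ (L⁺)ˣ` whose collection is `t.ε` (`locF a = t.ε`: `⟨a⟩` is a hermitian
line of record for `ω_V(t)`, with the SAME finite local classes as the pin's representative `(r μ hμ).toFun t.ε`) and whose archimedean signs are decided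
by `Φ_μ(t)`: `τ ∈ Φ_μ(t) ↔ 0 < im τ(imagUnit · a)` for EVERY complex embedding `τ`. [cite: Liu2021, Def. 4.12 (ll. 2102–2108); App. D Lem. D.2 (2)] -/
theorem exists_admissibleLine
    (hDel : Literature.AlgebraicGeometry.ShimuraVarieties.UnitaryCanonicalModel.canonicalModel_exists_printed)
    (F : HodgeCM.CMField) [IsGalois ℚ F] {ι₁ : F →+* ℂ} (V : HodgeCM.HermSpace3 F ι₁) (a₀ : RealScalar F) (Φ : CMType F)
    (i : (I V (repAt a₀) (muLiu ι₁ GramClass.rep))) (t : (datum413 hDel F V a₀ Φ i).Triple) (ht : t.IsAdmissible) :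
    ∃ (e : HodgeCM.CMField.K F) (a : (↥(maximalRealSubfield (HodgeCM.CMField.K F)))ˣ),
      IsAdmissibleElement (HodgeCM.CMField.K F) t.cmType.1 e ∧
        locF (↥(maximalRealSubfield (HodgeCM.CMField.K F))) (imagUnitSq (HodgeCM.CMField.K F)) a = t.ε ∧
          ((a : ↥(maximalRealSubfield (HodgeCM.CMField.K F))) : HodgeCM.CMField.K F) =
              (e * (2 * imagUnit (HodgeCM.CMField.K F))) ∧
            ∀ τ : HodgeCM.CMField.K F →+* ℂ, τ ∈ t.cmType.1 ↔
              0 < (τ (imagUnit (HodgeCM.CMField.K F) * ((a : ↥(maximalRealSubfield (HodgeCM.CMField.K F))) : HodgeCM.CMField.K F))).im := by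
  obtain ⟨e, he, hε⟩ := ht
  refine ⟨e, Units.mk0 ⟨e * (2 * imagUnit (HodgeCM.CMField.K F)), lineScalar_mem (complexConj_imagUnit _) he.2.1⟩
      (lineScalar_subtype_ne_zero (complexConj_imagUnit _) (imagUnit_ne_zero _) he.2.1 he.1), he, ?_, rfl, fun τ => ?_⟩
  · rw [← hε, datum413_epsOf]
    exact (epsOf_eq_locF_mk0 _ (complexConj_imagUnit _) (imagUnit_ne_zero _) he.2.1 he.1).symm
  · exact IsAdmissibleElement.mem_iff_im_pos t.cmType he (complexConj_imagUnit _) (imagUnit_ne_zero _) τ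

set_option synthInstance.maxHeartbeats 400000 in
set_option maxHeartbeats 8000000 in
/-- **THE `ι₁`-CLASS OF AN ADMISSIBLE TRIPLE, DECIDED AT ITS ADMISSIBLE LINE** (TASK 0 of DECISIONS-T3a v1, in kernel currency): for the witness `e` of
`t.IsAdmissible`, `ι₁ ∈ Φ_μ(t)` iff the real line scalar `e · 2·imagUnit` is positive at `ι₁` EXACTLY WHEN `im ι₁(imagUnit (K F))` is.  Hence the
disjunct of `StubT3aHolThetaRealisationAt` that holds is the one selected by the sign of `im ι₁(imagUnit (K F))` once «positive line at `ι₁` ⇒ holomorphic»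
is applied to the admissible line. [cite: Liu2021, Def. 4.12 (ll. 2102–2108); App. D Lem. D.2 (2)] -/
theorem mem_cmType_iff_of_isAdmissibleElement
    (hDel : Literature.AlgebraicGeometry.ShimuraVarieties.UnitaryCanonicalModel.canonicalModel_exists_printed)
    (F : HodgeCM.CMField) [IsGalois ℚ F] {ι₁ : F →+* ℂ} (V : HodgeCM.HermSpace3 F ι₁) (a₀ : RealScalar F) (Φ : CMType F)
    (i : (I V (repAt a₀) (muLiu ι₁ GramClass.rep))) (t : (datum413 hDel F V a₀ Φ i).Triple) {e : HodgeCM.CMField.K F}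
    (he : IsAdmissibleElement (HodgeCM.CMField.K F) t.cmType.1 e) (τ : HodgeCM.CMField.K F →+* ℂ) :
    τ ∈ t.cmType.1 ↔ (0 < (τ ((e * (2 * imagUnit (HodgeCM.CMField.K F))))).re ↔ 0 < (τ (imagUnit (HodgeCM.CMField.K F))).im) :=
  IsAdmissibleElement.mem_iff_re_pos_iff t.cmType he (complexConj_imagUnit _) (imagUnit_ne_zero _) τ

end Pin

end Summit.HodgeConjecture.HodgeConjecture.Cruxes.H413.AdmissibleLine

end
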